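import Literature.MathematicalPhysics.QuantumFieldTheory.BalabanBanachStep
import HarnessLib

/-!
# The two-orbit chart: Bałaban's renormalisation step read along pairs of Wilson orbits
# (hypothesis structure)

`TwoOrbitChart G r M` is a HYPOTHESIS STRUCTURE (data + the properties consumers use, NO
existence claim inside), in the manner of its ancestor `BalabanBanachStep G r M` (this directory)
and of `Literature.MathematicalPhysics.QuantumLattice.BlockRGScheme`. It is the *F-free,
orbitwise, infinite-volume* slimming of `BalabanBanachStep`: instead of positing ONE complete
renormalisation transformation `F(g, y) = (φ g y, Ψ g y)` of four-dimensional pure lattice gauge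
theory (compact gauge group `G`, Wilson's action in the faithful unitary representation `r`,
block factor `M`) as a map on a Banach chart `ℝ × E`, it records only what that map does ALONG
ORBITS OF WILSON POINTS — the chart coordinates `orb g j ∈ ℝ × E` of the effective theory after
`j` complete block-spin steps `ρ_{j+1} = R T ρ_j` started from Wilson's action `ρ₀ =
exp[−(1/g₀²)A − E]` [Balaban1988Convergent, Thm. 1 p. 262: the sequence of densities generated
by successive applications of `RT` to `ρ₀` satisfies all the inductive assumptions, as long as
the running couplings determined by the recursive (Callan–Symanzik) equations (0.18), (0.20) of
Balaban1987RG1 stay in the window (0.33); second remark p. 262: "the operation RT transforms the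
space with the index k into the space with the index k + 1"; Cor. 3 p. 264 (ultraviolet
stability); Balaban1989LargeFieldII Thm. 1 for the large-field `R` operation; Dimock2013
§1.2–§2.1 for the scalar re-exposition "block average (L odd), then rescale to the unit
lattice"] — together with the way the observables of these effective theories are realised.
It is the object consumed by the crux line `two-orbit-synchronisation` of
`ContinuumLimitOnTrajectory` (route `ParabolicTrajectory` of `YangMills`), whose hardest stub is
precisely `∀ G r, ∃ M₀, ∀ M ≥ M₀, Nonempty (TwoOrbitChart G r M)` — an OPEN PROBLEM, not asserted
here.

## Fields (five groups)

1. the fibre: a real Banach space `E` (irrelevant directions; one step-adapted norm recorded);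
   the coupling window `[0, γ]` and the small-fibre radius `ρ`;
2. the Wilson dictionary: chart couplings `g ∈ (0, g₀]`, `g₀ ≤ γ`, inverse bare coupling
   `betaOf g` onto `[B₀, ∞)` (`betaOf_surj`) and bounded on every `[g₁, g₀]`, `g₁ > 0`
   (`betaOf_bddOn`; so `betaOf (g k) → ∞` forces `g k → 0⁺`) — the orbitwise weakening of
   `BalabanBanachStep.betaOf` (`β(g) = κ/g² + O(1)`, strictly decreasing, continuous);
3. the orbits `orb : ℝ → ℕ → ℝ × E` with `(orb g 0).1 = g`: parabolic DRIFT of the marginal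
   (coupling) coordinate while the history is in the window, `(b/2) c³ ≤ c₊ − c ≤ 2 b c³`,
   `b > 0` (asymptotic freedom: `φ g y = g + b g³ + O(g⁴ + g³‖y‖)` in the ancestor; Bałaban's
   recursion (0.18)–(0.20) and the `(a + b log ε⁻¹)^{-1/2}` behaviour of the bare coupling
   [Balaban1988Convergent, p. 244]); transient ABSORPTION of the fibre into the `ρ`-ball after
   `j₀` in-window steps; and the two ORBITWISE DIFFERENCE INEQUALITIES between any two in-window
   small-fibre orbit points `(c, y) = orb g j`, `(c', y') = orb g' j'` on every sub-window
   `[0, γ'] ⊆ [0, γ]`, with constants `θ' < 1`, `Cκ, C₁, C₃ ≥ 0`: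
   `|c − c'| ≤ (1 + Cκ γ'²) |c₊ − c'₊| + C₃ γ'³ ‖y − y'‖` (marginal, read BACKWARDS, lossy) and
   `‖y₊ − y'₊‖ ≤ θ' ‖y − y'‖ + C₁ |c − c'|` (fibre, read FORWARDS, contracting, with NO additive
   residue — this is where Lipschitz control of large-field DIFFERENCES is assumed; the
   orbitwise counterparts of the ancestor's `lipschitz_base` / `lipschitz_fibre` / `contraction`);
4. the realisation: infinite-volume curvature `n`-point functions `expectInf p n f` of the
   effective theory at the chart point `p`, with (4a) exact RG covariance along orbits — one step
   = block dilation `blockDilate M` of the test functions [Balaban1988Convergent (0.1);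
   Dimock2013 §2.1], (4b) identification, at the Wilson point `orb g 0`, with the
   THERMODYNAMIC LIMIT `L → ∞` of the centred unit-lattice Wilson curvature `n`-point functions
   `wilsonCentredSchwinger r.ρ (betaOf g) L 1 n (curvature…) f` on the odd tori `2L+1`, and
   (4c) continuity of `p ↦ expectInf p n ((blockDilate M)^[m] ∘ f)` on the small-fibre window
   `W = [0, γ] × B̄_ρ` for off-diagonal tuples (`IsOffDiagonal`, the class of `IsYangMillsFor`);
5. the readout: the infinite-volume point-split curvature time-correlator `corrInf g t =
   lim_S ⟨P ; τ_t P⟩_{betaOf g, 2S+1}` (`corr_tendsto`, `latticeConnectedCorr`), its PIN (`pin`: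
   at every offset `m`, floor `g_low` and sub-window `γ'` some separation `t` makes the
   dimensionless readout `(M^{J+m})⁸ corrInf g (t M^{J+m})` injective in the terminal coupling of
   deep `γ'`-histories up to a RELATIVE fibre slack `ℓ₀ γ'` and a depth slack `η (min J J') → 0`),
   asymptotic-freedom smallness of the readout deep in the window (`uv_small`) and the
   IR-junction field `exit_massive` (theories near the exit of the sub-window are massive: their
   readout at `≥ M^{m₀}` blocks is uniformly small).

## Exact forms fixed here, and deviations from `BalabanBanachStep`

* No map `F`, no linear part `A`, no chart radius `δ`: nothing is asked at points off
  Wilson-started orbits, and the difference inequalities are TWO-POINT statements along orbits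
  (any two depths `j, j'`), not Lipschitz bounds of a map. The marginal inequality is the robust
  LOSSY form (factor `1 + Cκ γ'²`, no `o(g³)` precision), which is what a backward reading of
  `φ g y − φ g' y' = (g − g') + b (g³ − g'³) + O(γ'²)|g − g'| + O(γ'³)‖y − y'‖` gives.
* Infinite volume: `expectInf` has no torus-size argument (the ancestor's `expect p S …` lives
  on the torus of `S` sites), so the parity of `M` and the `M`-adic block tori never enter; the
  price is that (4b) is an identification with a thermodynamic LIMIT (`Tendsto … atTop`), whose
  existence at weak coupling is part of the burden of whoever inhabits the structure. The
  multiplicative normalisation is pinned to `1` and only the curvature species `r.curvature`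
  (`tr F_{μν}F_{μν}`, canonical dimension four, whence the exponent `8 = 2 · 4` of the
  dimensionless two-point readout) is realised.
* (4c) is required for every iterate `(blockDilate M)^[m] ∘ f` (all `m`), on the window
  `[0, γ] × B̄_ρ` only, and only for tuples whose tensor product is off-diagonal (at coinciding
  points contact terms diverge and continuity would fail for every instance).
* `exit_massive` is written with the separation `1 * M ^ (J + m)` so that it is literally the
  readout `TwoOrbitChart.Rd m 1 g J` (see `exit_massive_Rd`).
* `betaOf` is only asked to be onto `[B₀, ∞)` and locally bounded on `(0, g₀]`; `orb`, `corrInf`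
  are total functions whose values off `g ∈ (0, g₀]` are never constrained (junk).

## What is NOT here

No existence statement (the crux), no value of `b` or of the one-loop coefficient, no
large-field/small-field decomposition, no claim that Bałaban's densities determine correlation
functions, no thermodynamic limit theorem, no monotonicity of `betaOf`: all of that is the
burden of whoever inhabits the structure. The API below is elementary bookkeeping PROVED from
the fields (positivity and monotonicity of in-window couplings, drift counting, every Wilson
orbit leaves the window, iterated covariance, the window region is closed and complete).
-/

open scoped SchwartzMap
open MeasureTheory Filter Topology
open Literature.MathematicalPhysics.AQFT Literature.MathematicalPhysics.QuantumLattice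
open Literature.Probability.LatticeModels

noncomputable section

namespace Literature.MathematicalPhysics.QuantumFieldTheory

/-- **Two-orbit chart** for `(G, r, M)` — HYPOTHESIS STRUCTURE (no existence inside): Bałaban's
complete renormalisation step of four-dimensional lattice gauge theory with Wilson's action in
the representation `r` and block factor `M`, read ALONG ORBITS OF WILSON POINTS in Banach
coordinates `orb g j ∈ ℝ × E` (`j` complete block-spin steps from Wilson's action at chart
coupling `g`, inverse bare coupling `betaOf g`, onto every large `β`): parabolic drift of the
marginal coordinate while in the window `[0, γ]` (`b > 0`, asymptotic freedom); absorption of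
the fibre into the `ρ`-ball after `j₀` steps; the two ORBITWISE DIFFERENCE INEQUALITIES between
any two in-window small-fibre orbit points on every sub-window `[0, γ']` (marginal, backward,
lossy factor `1 + Cκ γ'²`; fibre, forward, contraction `θ' < 1` with coupling feed `C₁` and NO
additive residue); realised infinite-volume curvature `n`-point functions `expectInf` with
exact RG covariance (block dilation of test functions), identification with the thermodynamic
limit of the centred unit-lattice Wilson curvature `n`-point functions at Wilson points, and
continuity on the small-fibre window for off-diagonal tuples; the infinite-volume point-split
curvature time-correlator `corrInf` with its PIN (readout injective in the terminal coupling at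
some separation `t`, up to relative fibre slack `ℓ₀ γ'` and depth slack `η → 0`), AF smallness
of the readout deep in the window, and massiveness of the theories at the exit of the window.
Inhabiting it for all `M ≥ M₀` is an open problem (crux line `two-orbit-synchronisation` of
`YangMills/ContinuumLimitOnTrajectory`); see the module docstring for the exact forms and the
deviations from `BalabanBanachStep`. [cite: Balaban1988Convergent, Thm. 1 p. 262 (with the second remark) and Cor. 3 p. 264] [cite: Balaban1987RG1, (0.18)–(0.20) and (0.33)] [cite: Balaban1989LargeFieldII, Thm. 1] [cite: Dimock2013, §1.2–§2.1] -/
structure TwoOrbitChart (G : Type) [Group G] [TopologicalSpace G] [IsTopologicalGroup G]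
    [CompactSpace G] [MeasurableSpace G] [BorelSpace G] (r : LatticeRep G) (M : ℕ) where
  /-- (1) The fibre space: irrelevant directions (step-adapted norm allowed, one recorded). -/
  E : Type
  [instNormedAddCommGroup : NormedAddCommGroup E]
  [instNormedSpace : NormedSpace ℝ E]
  [instCompleteSpace : CompleteSpace E]
  /-- The coupling window `[0, γ]`. -/
  γ : ℝ
  /-- The small-fibre radius. -/
  ρ : ℝ
  γ_pos : 0 < γ
  ρ_pos : 0 < ρ
  /-- (2) The range `(0, g₀]` of chart couplings of Wilson points, inside the window. -/
  g₀ : ℝ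
  g₀_pos : 0 < g₀
  g₀_le : g₀ ≤ γ
  /-- The Wilson dictionary: inverse bare coupling `betaOf g` of the tree's `wilsonMeasure r.ρ β`
  at the chart coupling `g ∈ (0, g₀]`. -/
  betaOf : ℝ → ℝ
  /-- Every inverse coupling `β ≥ B₀` is attained on `(0, g₀]`. -/
  B₀ : ℝ
  betaOf_surj : ∀ β : ℝ, B₀ ≤ β → ∃ g ∈ Set.Ioc (0 : ℝ) g₀, betaOf g = β
  /-- `betaOf` is bounded on every `[g₁, g₀]`, `g₁ > 0` (so `betaOf (g k) → ∞` forces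
  `g k → 0⁺`). -/
  betaOf_bddOn : ∀ g₁ : ℝ, 0 < g₁ → ∃ B : ℝ, ∀ g ∈ Set.Icc g₁ g₀, betaOf g ≤ B
  /-- (3) Orbits of Wilson points: `orb g j` = chart coordinates (coupling, fibre) of the
  effective theory after `j` complete renormalisation steps from Wilson's action at `g`. -/
  orb : ℝ → ℕ → ℝ × E
  orb_zero : ∀ g : ℝ, (orb g 0).1 = g
  /-- Parabolic coefficient of the coupling recursion (`b = b₀ log M` in the ancestor). -/
  b : ℝ
  b_pos : 0 < b
  /-- Parabolic drift (asymptotic freedom) while the history is in the window: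
  `(b/2) c³ ≤ c₊ − c ≤ 2 b c³`. -/
  drift : ∀ g ∈ Set.Ioc (0 : ℝ) g₀, ∀ j : ℕ, (∀ i ≤ j, (orb g i).1 ≤ γ) →
    (orb g j).1 + b / 2 * (orb g j).1 ^ 3 ≤ (orb g (j + 1)).1 ∧
      (orb g (j + 1)).1 ≤ (orb g j).1 + 2 * b * (orb g j).1 ^ 3
  /-- Length of the transient. -/
  j₀ : ℕ
  /-- Transient absorption: after `j₀` in-window steps the fibre is inside the `ρ`-ball. -/
  absorb : ∀ g ∈ Set.Ioc (0 : ℝ) g₀, ∀ j : ℕ, j₀ ≤ j → (∀ i ≤ j, (orb g i).1 ≤ γ) →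
    ‖(orb g j).2‖ ≤ ρ
  /-- Contraction rate of fibre differences. -/
  θ' : ℝ
  /-- Loss constant of the backward marginal inequality (factor `1 + Cκ γ'²`). -/
  Cκ : ℝ
  /-- Coupling feed of the fibre inequality. -/
  C₁ : ℝ
  /-- Fibre feed of the marginal inequality (factor `C₃ γ'³`). -/
  C₃ : ℝ
  θ'_nonneg : 0 ≤ θ'
  θ'_lt_one : θ' < 1
  Cκ_nonneg : 0 ≤ Cκ
  C₁_nonneg : 0 ≤ C₁
  C₃_nonneg : 0 ≤ C₃
  /-- Marginal difference inequality, read BACKWARDS (the earlier coupling difference is bounded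
  by the later one), in the robust lossy form, for any two in-window small-fibre orbit points on
  every sub-window `[0, γ']`. -/
  marg_diff : ∀ γ' : ℝ, 0 < γ' → γ' ≤ γ → ∀ g g' : ℝ, g ∈ Set.Ioc (0 : ℝ) g₀ →
    g' ∈ Set.Ioc (0 : ℝ) g₀ → ∀ j j' : ℕ, (orb g j).1 ∈ Set.Icc 0 γ' →
    (orb g' j').1 ∈ Set.Icc 0 γ' → ‖(orb g j).2‖ ≤ ρ → ‖(orb g' j').2‖ ≤ ρ →
      |(orb g j).1 - (orb g' j').1| ≤
        (1 + Cκ * γ' ^ 2) * |(orb g (j + 1)).1 - (orb g' (j' + 1)).1| +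
          C₃ * γ' ^ 3 * ‖(orb g j).2 - (orb g' j').2‖
  /-- Fibre difference inequality, read FORWARDS: contraction of fibre DIFFERENCES along two
  orbits, the coupling offset entering with constant `C₁`, and NO additive residue (Lipschitz
  control of large-field differences). -/
  fibre_diff : ∀ γ' : ℝ, 0 < γ' → γ' ≤ γ → ∀ g g' : ℝ, g ∈ Set.Ioc (0 : ℝ) g₀ →
    g' ∈ Set.Ioc (0 : ℝ) g₀ → ∀ j j' : ℕ, (orb g j).1 ∈ Set.Icc 0 γ' →
    (orb g' j').1 ∈ Set.Icc 0 γ' → ‖(orb g j).2‖ ≤ ρ → ‖(orb g' j').2‖ ≤ ρ →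
      ‖(orb g (j + 1)).2 - (orb g' (j' + 1)).2‖ ≤
        θ' * ‖(orb g j).2 - (orb g' j').2‖ + C₁ * |(orb g j).1 - (orb g' j').1|
  /-- (4) Realised infinite-volume curvature `n`-point functions of the effective theory at a
  chart point (unit normalisation, exact centring, curvature species only). -/
  expectInf : ℝ × E → (n : ℕ) → (Fin n → 𝓢(EuclideanSpace ℝ (Fin 4), ℝ)) → ℝ
  /-- (4a) Exact RG covariance along orbits: one step = block dilation of the test functions. -/
  expect_step : ∀ g ∈ Set.Ioc (0 : ℝ) g₀, ∀ (j n : ℕ)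
    (f : Fin n → 𝓢(EuclideanSpace ℝ (Fin 4), ℝ)),
    expectInf (orb g (j + 1)) n f = expectInf (orb g j) n fun i => blockDilate M (f i)
  /-- (4b) Identification: at a Wilson point the realised values are the thermodynamic limits
  (`L → ∞` along the odd tori `2L+1`) of the centred unit-lattice Wilson curvature `n`-point
  functions with unit normalisation. -/
  expect_wilson : ∀ g ∈ Set.Ioc (0 : ℝ) g₀, ∀ (n : ℕ)
    (f : Fin n → 𝓢(EuclideanSpace ℝ (Fin 4), ℝ)),
    Tendsto (fun L : ℕ =>
      wilsonCentredSchwinger r.ρ (betaOf g) L (fun _ => 1) n (fun _ => r.curvature) f)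
      atTop (𝓝 (expectInf (orb g 0) n f))
  /-- (4c) Continuity of the realised off-diagonal `n`-point functions, and of all their block
  dilates, on the small-fibre window `[0, γ] × B̄_ρ`. -/
  continuousOn_expect : ∀ (n m : ℕ) (f : Fin n → 𝓢(EuclideanSpace ℝ (Fin 4), ℝ)),
    IsOffDiagonal (SchwartzMap.tensorFin n fun i => ofRealTest (f i)) →
      ContinuousOn (fun p : ℝ × E => expectInf p n fun i => (blockDilate M)^[m] (f i))
        (Set.Icc 0 γ ×ˢ Metric.closedBall (0 : E) ρ)
  /-- (5) The infinite-volume point-split curvature time-correlator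
  `corrInf g t = ⟨P ; τ_t P⟩_{betaOf g, ∞}`, `P = r.curvature.F`. -/
  corrInf : ℝ → ℕ → ℝ
  /-- `corrInf g t` is the thermodynamic limit of the connected torus correlators. -/
  corr_tendsto : ∀ g ∈ Set.Ioc (0 : ℝ) g₀, ∀ t : ℕ,
    Tendsto (fun S : ℕ =>
      latticeConnectedCorr r.ρ (betaOf g) (2 * S + 1) r.curvature.F r.curvature.F t)
      atTop (𝓝 (corrInf g t))
  /-- Relative fibre slack of the pin. -/
  ℓ₀ : ℝ
  ℓ₀_nonneg : 0 ≤ ℓ₀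
  /-- THE PIN: at offset `m`, on terminal couplings in `[g_low, γ']` of deep `γ'`-histories with
  small fibres, some separation `t` makes the dimensionless readout
  `(M^{J+m})⁸ corrInf g (t M^{J+m})` injective in the marginal coordinate, up to a RELATIVE
  fibre slack `ℓ₀ γ'` and a depth slack `η (min J J') → 0`. -/
  pin : ∀ (m : ℕ) (g_low γ' : ℝ), 0 < g_low → 0 < γ' → γ' ≤ γ →
    ∃ t : ℕ, 0 < t ∧ ∃ c_r : ℝ, 0 < c_r ∧ ∃ η : ℕ → ℝ, Tendsto η atTop (𝓝 0) ∧
      ∀ g g' : ℝ, g ∈ Set.Ioc (0 : ℝ) g₀ → g' ∈ Set.Ioc (0 : ℝ) g₀ → ∀ J J' : ℕ,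
        j₀ ≤ J → j₀ ≤ J' → (∀ i ≤ J, (orb g i).1 ≤ γ') → (∀ i ≤ J', (orb g' i).1 ≤ γ') →
        g_low ≤ (orb g J).1 → g_low ≤ (orb g' J').1 →
        ‖(orb g J).2‖ ≤ ρ → ‖(orb g' J').2‖ ≤ ρ →
          c_r * |(orb g J).1 - (orb g' J').1| ≤
            |((M : ℝ) ^ (J + m)) ^ 8 * corrInf g (t * M ^ (J + m)) -
                ((M : ℝ) ^ (J' + m)) ^ 8 * corrInf g' (t * M ^ (J' + m))| +
              c_r * (ℓ₀ * γ') * ‖(orb g J).2 - (orb g' J').2‖ + η (min J J')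
  /-- Asymptotic-freedom smallness of the readout deep in the window: in-window orbit points of
  depth `≥ j₀` with coupling `≤ gε` have readout `≤ ε`. -/
  uv_small : ∀ (m t : ℕ) (ε : ℝ), 0 < ε → ∃ gε : ℝ, 0 < gε ∧ ∀ g ∈ Set.Ioc (0 : ℝ) g₀,
    ∀ J : ℕ, j₀ ≤ J → (∀ i ≤ J, (orb g i).1 ≤ γ) → (orb g J).1 ≤ gε →
      |((M : ℝ) ^ (J + m)) ^ 8 * corrInf g (t * M ^ (J + m))| ≤ ε
  /-- IR junction: the effective theories at the exit of the sub-window `[0, γ']` (coupling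
  `≥ γ'/2`) are massive — their dimensionless curvature correlator at `≥ M^{m₀}` blocks is
  small, uniformly (separation written `1 * M ^ (J + m)`, literally `Rd m 1 g J`). -/
  exit_massive : ∀ γ' : ℝ, 0 < γ' → γ' ≤ γ → ∀ ε : ℝ, 0 < ε → ∃ m₀ : ℕ, ∀ m : ℕ, m₀ ≤ m →
    ∀ g ∈ Set.Ioc (0 : ℝ) g₀, ∀ J : ℕ, j₀ ≤ J → (∀ i ≤ J, (orb g i).1 ≤ γ') →
      γ' / 2 ≤ (orb g J).1 →
        |((M : ℝ) ^ (J + m)) ^ 8 * corrInf g (1 * M ^ (J + m))| ≤ ε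

namespace TwoOrbitChart

attribute [instance] instNormedAddCommGroup instNormedSpace instCompleteSpace

variable {G : Type} [Group G] [TopologicalSpace G] [IsTopologicalGroup G] [CompactSpace G]
  [MeasurableSpace G] [BorelSpace G] {r : LatticeRep G} {M : ℕ} (𝒞 : TwoOrbitChart G r M)

/-! ### The readout and the window region -/

/-- **The dimensionless readout** at offset `m`, separation `t`, along the orbit of `g` at depth
`J`: `(M^{J+m})⁸ · ⟨P ; τ_{t M^{J+m}} P⟩_{betaOf g, ∞}` — for `J + m = n_k` the infinite-volume
version of the dimensionless curvature two-point tower `N_t(k)` at spacing `M^{-n_k}`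
(exponent `8` = twice the canonical dimension of `tr F²`). [folklore] -/
def Rd (m t : ℕ) (g : ℝ) (J : ℕ) : ℝ := ((M : ℝ) ^ (J + m)) ^ 8 * 𝒞.corrInf g (t * M ^ (J + m))

/-- Unfolding `Rd`. [folklore] -/
theorem Rd_def (m t : ℕ) (g : ℝ) (J : ℕ) :
    𝒞.Rd m t g J = ((M : ℝ) ^ (J + m)) ^ 8 * 𝒞.corrInf g (t * M ^ (J + m)) := rfl

/-- **The small-fibre window region** `W = [0, γ] × B̄_ρ ⊆ ℝ × E` on which continuity (4c) is
stated. [folklore] -/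
def W : Set (ℝ × 𝒞.E) := Set.Icc 0 𝒞.γ ×ˢ Metric.closedBall (0 : 𝒞.E) 𝒞.ρ

/-- Membership in `W`: coupling in `[0, γ]` and fibre of norm `≤ ρ`. [folklore] -/
theorem mem_W {p : ℝ × 𝒞.E} : p ∈ 𝒞.W ↔ p.1 ∈ Set.Icc 0 𝒞.γ ∧ ‖p.2‖ ≤ 𝒞.ρ := by
  simp only [W, Set.mem_prod, Metric.mem_closedBall, dist_zero_right]

/-- `W` is closed. [folklore] -/
theorem isClosed_W : IsClosed 𝒞.W := isClosed_Icc.prod Metric.isClosed_closedBall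

/-- `W` is complete (a closed subset of the Banach space `ℝ × E`): Cauchy sequences of window
points converge in `W`. [folklore] -/
theorem isComplete_W : IsComplete 𝒞.W := 𝒞.isClosed_W.isComplete

/-- (4c) restated on `W`. [folklore] -/
theorem continuousOn_expect_W (n m : ℕ) (f : Fin n → 𝓢(EuclideanSpace ℝ (Fin 4), ℝ))
    (hf : IsOffDiagonal (SchwartzMap.tensorFin n fun i => ofRealTest (f i))) :
    ContinuousOn (fun p : ℝ × 𝒞.E => 𝒞.expectInf p n fun i => (blockDilate M)^[m] (f i)) 𝒞.W :=
  𝒞.continuousOn_expect n m f hf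

/-- The pin, phrased with the readout `Rd`. [folklore] -/
theorem pin_Rd (m : ℕ) {g_low γ' : ℝ} (hg_low : 0 < g_low) (hγ' : 0 < γ') (hγ'le : γ' ≤ 𝒞.γ) :
    ∃ t : ℕ, 0 < t ∧ ∃ c_r : ℝ, 0 < c_r ∧ ∃ η : ℕ → ℝ, Tendsto η atTop (𝓝 0) ∧
      ∀ g g' : ℝ, g ∈ Set.Ioc (0 : ℝ) 𝒞.g₀ → g' ∈ Set.Ioc (0 : ℝ) 𝒞.g₀ → ∀ J J' : ℕ,
        𝒞.j₀ ≤ J → 𝒞.j₀ ≤ J' → (∀ i ≤ J, (𝒞.orb g i).1 ≤ γ') →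
        (∀ i ≤ J', (𝒞.orb g' i).1 ≤ γ') → g_low ≤ (𝒞.orb g J).1 → g_low ≤ (𝒞.orb g' J').1 →
        ‖(𝒞.orb g J).2‖ ≤ 𝒞.ρ → ‖(𝒞.orb g' J').2‖ ≤ 𝒞.ρ →
          c_r * |(𝒞.orb g J).1 - (𝒞.orb g' J').1| ≤
            |𝒞.Rd m t g J - 𝒞.Rd m t g' J'| +
              c_r * (𝒞.ℓ₀ * γ') * ‖(𝒞.orb g J).2 - (𝒞.orb g' J').2‖ + η (min J J') :=
  𝒞.pin m g_low γ' hg_low hγ' hγ'le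

/-- AF smallness, phrased with the readout `Rd`. [folklore] -/
theorem uv_small_Rd (m t : ℕ) {ε : ℝ} (hε : 0 < ε) :
    ∃ gε : ℝ, 0 < gε ∧ ∀ g ∈ Set.Ioc (0 : ℝ) 𝒞.g₀, ∀ J : ℕ, 𝒞.j₀ ≤ J →
      (∀ i ≤ J, (𝒞.orb g i).1 ≤ 𝒞.γ) → (𝒞.orb g J).1 ≤ gε → |𝒞.Rd m t g J| ≤ ε :=
  𝒞.uv_small m t ε hε

/-- The IR junction, phrased with the readout `Rd` at separation `t = 1`. [folklore] -/
theorem exit_massive_Rd {γ' : ℝ} (hγ' : 0 < γ') (hγ'le : γ' ≤ 𝒞.γ) {ε : ℝ} (hε : 0 < ε) :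
    ∃ m₀ : ℕ, ∀ m : ℕ, m₀ ≤ m → ∀ g ∈ Set.Ioc (0 : ℝ) 𝒞.g₀, ∀ J : ℕ, 𝒞.j₀ ≤ J →
      (∀ i ≤ J, (𝒞.orb g i).1 ≤ γ') → γ' / 2 ≤ (𝒞.orb g J).1 → |𝒞.Rd m 1 g J| ≤ ε :=
  𝒞.exit_massive γ' hγ' hγ'le ε hε

/-! ### Iterated covariance -/

/-- **Iterated covariance along an orbit**: `J` steps = `J`-fold block dilation of the test
functions, `expectInf (orb g J) n f = expectInf (orb g 0) n ((blockDilate M)^[J] ∘ f)`.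
[folklore] -/
theorem expect_iterate {g : ℝ} (hg : g ∈ Set.Ioc (0 : ℝ) 𝒞.g₀) (J n : ℕ)
    (f : Fin n → 𝓢(EuclideanSpace ℝ (Fin 4), ℝ)) :
    𝒞.expectInf (𝒞.orb g J) n f =
      𝒞.expectInf (𝒞.orb g 0) n fun i => (blockDilate M)^[J] (f i) := by
  induction J generalizing f with
  | zero => simp
  | succ J ih =>
    rw [𝒞.expect_step g hg J n f, ih]
    congr 1

/-- At a Wilson point, the realised values along the orbit are thermodynamic limits of centred
unit-lattice Wilson `n`-point functions with `J`-fold dilated test functions ((4a) + (4b)).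
[folklore] -/
theorem tendsto_wilson_orb {g : ℝ} (hg : g ∈ Set.Ioc (0 : ℝ) 𝒞.g₀) (J n : ℕ)
    (f : Fin n → 𝓢(EuclideanSpace ℝ (Fin 4), ℝ)) :
    Tendsto (fun L : ℕ => wilsonCentredSchwinger r.ρ (𝒞.betaOf g) L (fun _ => 1) n
        (fun _ => r.curvature) fun i => (blockDilate M)^[J] (f i))
      atTop (𝓝 (𝒞.expectInf (𝒞.orb g J) n f)) := by
  rw [𝒞.expect_iterate hg J n f]
  exact 𝒞.expect_wilson g hg n _

/-! ### Drift bookkeeping along in-window histories -/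

/-- The coupling coordinate stays positive along an in-window history started at a Wilson point
`g ∈ (0, g₀]`. [folklore] -/
theorem orb_fst_pos {g : ℝ} (hg : g ∈ Set.Ioc (0 : ℝ) 𝒞.g₀) {j : ℕ}
    (hw : ∀ i < j, (𝒞.orb g i).1 ≤ 𝒞.γ) : 0 < (𝒞.orb g j).1 := by
  induction j with
  | zero => rw [𝒞.orb_zero]; exact hg.1
  | succ j ih =>
    have hpos : 0 < (𝒞.orb g j).1 := ih fun i hi => hw i (Nat.lt_succ_of_lt hi)
    have hd := (𝒞.drift g hg j fun i hi => hw i (Nat.lt_succ_of_le hi)).1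
    have hb : 0 < 𝒞.b / 2 * (𝒞.orb g j).1 ^ 3 := by have := 𝒞.b_pos; positivity
    linarith

/-- One in-window step increases the coupling strictly (asymptotic freedom read towards the
infrared). [folklore] -/
theorem orb_fst_lt_succ {g : ℝ} (hg : g ∈ Set.Ioc (0 : ℝ) 𝒞.g₀) {j : ℕ}
    (hw : ∀ i ≤ j, (𝒞.orb g i).1 ≤ 𝒞.γ) : (𝒞.orb g j).1 < (𝒞.orb g (j + 1)).1 := by
  have hpos : 0 < (𝒞.orb g j).1 := 𝒞.orb_fst_pos hg fun i hi => hw i hi.le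
  have hd := (𝒞.drift g hg j hw).1
  have hb : 0 < 𝒞.b / 2 * (𝒞.orb g j).1 ^ 3 := by have := 𝒞.b_pos; positivity
  linarith

/-- The coupling is monotone along an in-window stretch. [folklore] -/
theorem orb_fst_mono {g : ℝ} (hg : g ∈ Set.Ioc (0 : ℝ) 𝒞.g₀) {i j : ℕ} (hij : i ≤ j)
    (hw : ∀ l < j, (𝒞.orb g l).1 ≤ 𝒞.γ) : (𝒞.orb g i).1 ≤ (𝒞.orb g j).1 := by
  induction j with
  | zero => rw [Nat.le_zero.1 hij]
  | succ j ih =>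
    rcases hij.lt_or_eq with h | h
    · exact (ih (Nat.lt_succ_iff.1 h) fun l hl => hw l (Nat.lt_succ_of_lt hl)).trans
        (𝒞.orb_fst_lt_succ hg fun l hl => hw l (Nat.lt_succ_of_le hl)).le
    · rw [h]

/-- In particular the coupling never drops below its Wilson value `g` while in the window.
[folklore] -/
theorem le_orb_fst {g : ℝ} (hg : g ∈ Set.Ioc (0 : ℝ) 𝒞.g₀) {j : ℕ}
    (hw : ∀ i < j, (𝒞.orb g i).1 ≤ 𝒞.γ) : g ≤ (𝒞.orb g j).1 := by
  have h := 𝒞.orb_fst_mono hg (Nat.zero_le j) hw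
  rwa [𝒞.orb_zero] at h

/-- **Drift counting**: after `j` in-window steps the coupling has grown by at least
`j · (b/2) g³`. [folklore] -/
theorem add_mul_le_orb_fst {g : ℝ} (hg : g ∈ Set.Ioc (0 : ℝ) 𝒞.g₀) {j : ℕ}
    (hw : ∀ i < j, (𝒞.orb g i).1 ≤ 𝒞.γ) : g + j * (𝒞.b / 2 * g ^ 3) ≤ (𝒞.orb g j).1 := by
  induction j with
  | zero => simp [𝒞.orb_zero]
  | succ j ih =>
    have hw' : ∀ i < j, (𝒞.orb g i).1 ≤ 𝒞.γ := fun i hi => hw i (Nat.lt_succ_of_lt hi)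
    have hwj : ∀ i ≤ j, (𝒞.orb g i).1 ≤ 𝒞.γ := fun i hi => hw i (Nat.lt_succ_of_le hi)
    have h1 := ih hw'
    have hgle : g ≤ (𝒞.orb g j).1 := 𝒞.le_orb_fst hg hw'
    have hd := (𝒞.drift g hg j hwj).1
    have hcube : g ^ 3 ≤ (𝒞.orb g j).1 ^ 3 := pow_le_pow_left₀ hg.1.le hgle 3
    have h2 : 𝒞.b / 2 * g ^ 3 ≤ 𝒞.b / 2 * (𝒞.orb g j).1 ^ 3 :=
      mul_le_mul_of_nonneg_left hcube (by have := 𝒞.b_pos; positivity)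
    push_cast
    linarith

/-- **Every Wilson orbit leaves the window**: the in-window stretch of the orbit of any
`g ∈ (0, g₀]` is finite (the coupling grows at least linearly while inside). [folklore] -/
theorem exists_lt_orb_fst {g : ℝ} (hg : g ∈ Set.Ioc (0 : ℝ) 𝒞.g₀) :
    ∃ j : ℕ, 𝒞.γ < (𝒞.orb g j).1 := by
  by_contra h
  have h' : ∀ j : ℕ, (𝒞.orb g j).1 ≤ 𝒞.γ := fun j => le_of_not_gt fun hj => h ⟨j, hj⟩
  have hstep : 0 < 𝒞.b / 2 * g ^ 3 := by have := 𝒞.b_pos; have := hg.1; positivity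
  obtain ⟨j, hj⟩ := exists_nat_gt ((𝒞.γ - g) / (𝒞.b / 2 * g ^ 3))
  have h1 := 𝒞.add_mul_le_orb_fst hg (j := j) fun i _ => h' i
  have h2 : 𝒞.γ - g < j * (𝒞.b / 2 * g ^ 3) := by rwa [div_lt_iff₀ hstep] at hj
  linarith [h' j]

/-- Exit from every sub-window `[0, γ']`, `γ' ≤ γ`. [folklore] -/
theorem exists_lt_orb_fst_of_le {g γ' : ℝ} (hg : g ∈ Set.Ioc (0 : ℝ) 𝒞.g₀) (hγ' : γ' ≤ 𝒞.γ) :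
    ∃ j : ℕ, γ' < (𝒞.orb g j).1 :=
  (𝒞.exists_lt_orb_fst hg).imp fun _ hj => hγ'.trans_lt hj

/-- **Geometric a priori bound inside a sub-window**: while the history is in `[0, γ']`,
`c_j ≤ g (1 + 2 b γ'²)^j` (from the upper drift bound `c₊ ≤ c (1 + 2 b c²)`); so the number of
in-window steps tends to infinity as `g → 0⁺`. [folklore] -/
theorem orb_fst_le_mul_pow {g γ' : ℝ} (hg : g ∈ Set.Ioc (0 : ℝ) 𝒞.g₀) (hγ' : γ' ≤ 𝒞.γ)
    {j : ℕ} (hw : ∀ i < j, (𝒞.orb g i).1 ≤ γ') :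
    (𝒞.orb g j).1 ≤ g * (1 + 2 * 𝒞.b * γ' ^ 2) ^ j := by
  induction j with
  | zero => simp [𝒞.orb_zero]
  | succ j ih =>
    have hw' : ∀ i < j, (𝒞.orb g i).1 ≤ γ' := fun i hi => hw i (Nat.lt_succ_of_lt hi)
    have hwγ : ∀ i ≤ j, (𝒞.orb g i).1 ≤ 𝒞.γ := fun i hi =>
      (hw i (Nat.lt_succ_of_le hi)).trans hγ'
    have hc0 : 0 < (𝒞.orb g j).1 := 𝒞.orb_fst_pos hg fun i hi => hwγ i hi.le
    have hcγ : (𝒞.orb g j).1 ≤ γ' := hw j (Nat.lt_succ_self j)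
    have hd := (𝒞.drift g hg j hwγ).2
    have hsq : (𝒞.orb g j).1 ^ 2 ≤ γ' ^ 2 := pow_le_pow_left₀ hc0.le hcγ 2
    have h2 : 2 * 𝒞.b * (𝒞.orb g j).1 ^ 3 ≤ 2 * 𝒞.b * ((𝒞.orb g j).1 * γ' ^ 2) := by
      refine mul_le_mul_of_nonneg_left ?_ (by have := 𝒞.b_pos; positivity)
      calc (𝒞.orb g j).1 ^ 3 = (𝒞.orb g j).1 * (𝒞.orb g j).1 ^ 2 := by ring
        _ ≤ (𝒞.orb g j).1 * γ' ^ 2 := mul_le_mul_of_nonneg_left hsq hc0.le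
    have h1 : (𝒞.orb g (j + 1)).1 ≤ (𝒞.orb g j).1 * (1 + 2 * 𝒞.b * γ' ^ 2) := by
      linarith
    have hq : 0 ≤ 1 + 2 * 𝒞.b * γ' ^ 2 := by have := 𝒞.b_pos; positivity
    calc (𝒞.orb g (j + 1)).1 ≤ (𝒞.orb g j).1 * (1 + 2 * 𝒞.b * γ' ^ 2) := h1
      _ ≤ g * (1 + 2 * 𝒞.b * γ' ^ 2) ^ j * (1 + 2 * 𝒞.b * γ' ^ 2) :=
          mul_le_mul_of_nonneg_right (ih hw') hq
      _ = g * (1 + 2 * 𝒞.b * γ' ^ 2) ^ (j + 1) := by ring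

/-- **First exit from a sub-window.** For a Wilson point `g ≤ γ'`, `γ' ≤ γ`, there is a first
step `J ≥ 1` at which the coupling exceeds `γ'`: the history before `J` is in `[0, γ']`, the
exit coupling is at most one drift step above `γ'` (`≤ γ' + 2 b γ'³`), and
`γ' < g (1 + 2 b γ'²)^J` (drift counting: `J → ∞` as `g → 0⁺`). [folklore] -/
theorem exists_first_exit {g γ' : ℝ} (hg : g ∈ Set.Ioc (0 : ℝ) 𝒞.g₀) (hγ' : γ' ≤ 𝒞.γ)
    (hgγ' : g ≤ γ') :
    ∃ J : ℕ, 0 < J ∧ (∀ i < J, (𝒞.orb g i).1 ≤ γ') ∧ γ' < (𝒞.orb g J).1 ∧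
      (𝒞.orb g J).1 ≤ γ' + 2 * 𝒞.b * γ' ^ 3 ∧ γ' < g * (1 + 2 * 𝒞.b * γ' ^ 2) ^ J := by
  classical
  have hex := 𝒞.exists_lt_orb_fst_of_le hg hγ'
  have hspec : γ' < (𝒞.orb g (Nat.find hex)).1 := Nat.find_spec hex
  have hmin : ∀ i < Nat.find hex, (𝒞.orb g i).1 ≤ γ' := fun i hi =>
    le_of_not_gt (Nat.find_min hex hi)
  have hpos : 0 < Nat.find hex :=
    (Nat.find_pos hex).2 (by rw [𝒞.orb_zero]; exact not_lt.2 hgγ')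
  refine ⟨Nat.find hex, hpos, hmin, hspec, ?_,
    hspec.trans_le (𝒞.orb_fst_le_mul_pow hg hγ' hmin)⟩
  obtain ⟨j, hj⟩ := Nat.exists_eq_succ_of_ne_zero hpos.ne'
  have hw : ∀ i ≤ j, (𝒞.orb g i).1 ≤ γ' := fun i hi => hmin i (by omega)
  have hc0 : 0 < (𝒞.orb g j).1 := 𝒞.orb_fst_pos hg fun i hi => (hw i hi.le).trans hγ'
  have hd := (𝒞.drift g hg j fun i hi => (hw i hi).trans hγ').2
  have hcube : (𝒞.orb g j).1 ^ 3 ≤ γ' ^ 3 := pow_le_pow_left₀ hc0.le (hw j le_rfl) 3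
  have h2 : 2 * 𝒞.b * (𝒞.orb g j).1 ^ 3 ≤ 2 * 𝒞.b * γ' ^ 3 :=
    mul_le_mul_of_nonneg_left hcube (by have := 𝒞.b_pos; positivity)
  rw [hj]
  linarith [hw j le_rfl]

/-- Deep in-window orbit points lie in the window region `W` (positivity of the coupling and
transient absorption of the fibre). [folklore] -/
theorem orb_mem_W {g : ℝ} (hg : g ∈ Set.Ioc (0 : ℝ) 𝒞.g₀) {j : ℕ} (hj : 𝒞.j₀ ≤ j)
    (hw : ∀ i ≤ j, (𝒞.orb g i).1 ≤ 𝒞.γ) : 𝒞.orb g j ∈ 𝒞.W :=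
  𝒞.mem_W.2 ⟨⟨(𝒞.orb_fst_pos hg fun i hi => hw i hi.le).le, hw j le_rfl⟩,
    𝒞.absorb g hg j hj hw⟩

end TwoOrbitChart

end Literature.MathematicalPhysics.QuantumFieldTheory

end
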